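import Mathlib

/-!
# `RegularTowerGap` — stub `stub_exponent_bump` (line Sketch, crux stmt-MatrixMultiplication-7358)

Pure real analysis: a strict inequality `∑ f i ^ (2/3) < P` for finitely many numbers
`f i ∈ [0, B]` with `1 ≤ B` persists at some exponent `τ ∈ (2/3, 1]`.

Proof: for `t > 0` and `0 ≤ x ≤ B`, `x ^ (2/3 + t) = x ^ (2/3) * x ^ t ≤ B ^ t * x ^ (2/3)`
(`Real.rpow_add'`, `Real.rpow_le_rpow`), so `∑ f i ^ (2/3 + t) ≤ B ^ t * ∑ f i ^ (2/3)`; the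
right-hand side is continuous in `t` and `< P` at `t = 0`, hence `< P` for some small `t ∈ (0, 1/3]`.
-/

set_option linter.dupNamespace false

noncomputable section

open Finset
open scoped BigOperators

namespace Summit.MatrixMultiplication.MatrixMultiplication.Theorems.RegularTowerGap

/-- Pointwise exponent bump: for `0 ≤ x ≤ B` and `0 < t`,
`x ^ (2/3 + t) ≤ B ^ t * x ^ (2/3)`. -/
theorem rpow_twoThirds_add_le {x B t : ℝ} (hx : 0 ≤ x) (hxB : x ≤ B) (ht : 0 < t) :
    x ^ ((2 : ℝ) / 3 + t) ≤ B ^ t * x ^ ((2 : ℝ) / 3) := by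
  have h23t : (2 : ℝ) / 3 + t ≠ 0 := by positivity
  rw [Real.rpow_add' hx h23t, mul_comm]
  exact mul_le_mul_of_nonneg_right (Real.rpow_le_rpow hx hxB ht.le) (Real.rpow_nonneg hx _)

/-- Summed exponent bump: if `0 ≤ f i ≤ B` on `s` and `0 < t`, then
`∑ f i ^ (2/3 + t) ≤ B ^ t * ∑ f i ^ (2/3)`. -/
theorem sum_rpow_twoThirds_add_le {α : Type*} (s : Finset α) (f : α → ℝ) {B t : ℝ}
    (hf0 : ∀ i ∈ s, 0 ≤ f i) (hfB : ∀ i ∈ s, f i ≤ B) (ht : 0 < t) :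
    ∑ i ∈ s, f i ^ ((2 : ℝ) / 3 + t) ≤ B ^ t * ∑ i ∈ s, f i ^ ((2 : ℝ) / 3) := by
  rw [Finset.mul_sum]
  exact Finset.sum_le_sum fun i hi => rpow_twoThirds_add_le (hf0 i hi) (hfB i hi) ht

/-- **Exponent bump** (stub `stub_exponent_bump` of the `RegularTowerGap` skeleton): a strict bound
`∑ f i ^ (2/3) < P` for finitely many `f i ∈ [0, B]`, `1 ≤ B`, persists at some exponent
`τ ∈ (2/3, 1]`. -/
theorem stub_exponent_bump :
    ∀ (α : Type) (s : Finset α) (f : α → ℝ) (B P : ℝ), 1 ≤ B → (∀ i ∈ s, 0 ≤ f i) →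
      (∀ i ∈ s, f i ≤ B) → ∑ i ∈ s, f i ^ ((2 : ℝ) / 3) < P →
        ∃ τ : ℝ, 2 / 3 < τ ∧ τ ≤ 1 ∧ ∑ i ∈ s, f i ^ τ < P := by
  intro α s f B P hB hf0 hfB hS
  have hB0 : B ≠ 0 := (lt_of_lt_of_le one_pos hB).ne'
  -- `t ↦ B ^ t * S` is continuous at `0`, where it equals `S < P`.
  have hcont : ContinuousAt (fun t : ℝ => B ^ t * ∑ i ∈ s, f i ^ ((2 : ℝ) / 3)) 0 :=
    (Real.continuousAt_const_rpow hB0).mul continuousAt_const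
  have h0 : (fun t : ℝ => B ^ t * ∑ i ∈ s, f i ^ ((2 : ℝ) / 3)) 0 < (fun _ : ℝ => P) 0 := by
    simpa only [Real.rpow_zero, one_mul] using hS
  have hev : ∀ᶠ t in nhds (0 : ℝ), B ^ t * ∑ i ∈ s, f i ^ ((2 : ℝ) / 3) < P :=
    hcont.eventually_lt continuousAt_const h0
  obtain ⟨ε, hε, hεP⟩ := Metric.eventually_nhds_iff.1 hev
  -- the bump `t := min (ε / 2) (1 / 3) ∈ (0, 1/3]` lies within `ε` of `0`.
  have ht_pos : 0 < min (ε / 2) (1 / 3) := lt_min (by linarith) (by norm_num)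
  have ht_le : min (ε / 2) (1 / 3) ≤ 1 / 3 := min_le_right _ _
  have ht_lt : min (ε / 2) (1 / 3) < ε := lt_of_le_of_lt (min_le_left _ _) (by linarith)
  have hdist : dist (min (ε / 2) (1 / 3)) 0 < ε := by
    rwa [Real.dist_0_eq_abs, abs_of_pos ht_pos]
  refine ⟨2 / 3 + min (ε / 2) (1 / 3), by linarith, by linarith, ?_⟩
  calc ∑ i ∈ s, f i ^ ((2 : ℝ) / 3 + min (ε / 2) (1 / 3))
      ≤ B ^ (min (ε / 2) (1 / 3)) * ∑ i ∈ s, f i ^ ((2 : ℝ) / 3) :=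
        sum_rpow_twoThirds_add_le s f hf0 hfB ht_pos
    _ < P := hεP hdist

end Summit.MatrixMultiplication.MatrixMultiplication.Theorems.RegularTowerGap

end
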